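import Literature.MathematicalPhysics.QuantumFieldTheory.Balaban1983to89.B9Eq342CovariantResolventAdjointRow
import Literature.MathematicalPhysics.QuantumFieldTheory.Balaban1983to89.B9Eq340HolderRowOfGradientRow
import Literature.MathematicalPhysics.QuantumFieldTheory.Balaban1983to89.B9Eq342CoshWeightBlockDistance

/-!
# `Balaban1983to89.B9Eq343CovariantResolventHolderLetters` — T. Bałaban, *Propagators for lattice gauge theories in a background field*, Commun. Math. Phys. **99**
# (1985) 389–434 [Balaban1985BackgroundPropagators] Thm 3.1 (3.43) p. 398, SECOND MEMBER `‖ζG′(U)∇*_Uλ‖_β` (the Hölder norm of `G′∇*_U`), with (3.40) p. 397 (the Hölder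
# norms) and (3.23) p. 394, FOR THE COVARIANT MASSIVE RESOLVENT — **THE LETTERS OF THE HÖLDER TWIN of this lineage's perturbative road
# (`B9Eq342CovariantResolventAdjointRow`): (i) the product-`cosh` weight over a sup-ball (`W_{x₀}(p) ≤ e^{a·d·r}W_{x₀}(x)` for `d(p,x) ≤ r`); (ii) the TWO-POINT
# (η-scale Lipschitz, hence Hölder) row of `(Δ_{RS} + m)⁻¹` on weighted VALUE data from a DISPLAYED covariant-gradient letter, Kato's weighted value row and the lattice
# path lemma of `B9Eq340HolderRowOfGradientRow`; (iii) the two-point A-PRIORI bound of `(Δ_{RS} + m)⁻¹D*_S` (finite dimension) in the Hölder currency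
# `Θ·F·(d(x,x′)∕ℓ)^β·W_{x₀}(x)`** — so that the Hölder adjoint row can be bootstrapped exactly as the value row was (next file), the flat two-point letter displayed

statement-level skeleton of published theorems with citation tags; proofs where landed; nothing here is a claim about the Yang–Mills mass gap

CITATION HEADER (lean-in-tree rule).  Audit cell `pub-balaban`, sub-cell `t4`, BINDER row NE9; filed by NE9 crux-team LEAF PROVER 01 (`b2b-balaban-t4-ne9-formalise-leaf-01`,
gen 93; bears_on: R4/N22).  Source READ first-hand (`paper:balaban1985-cmp99-background-propagators`): p. 397 (3.40) *«‖f‖_α = sup_{x,x′} |x − x′|^{−α}|U(Γ_{x,x′})f(x′) −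
f(x)|»* (the cell reads PLAIN pair differences over `tdist ≤ L^{n+1}`, declared in `B9Eq343BlockLocalisedHolderPieces`∕`B9Eq340HolderRowOfGradientRow`), p. 398 Thm 3.1
(3.43); p. 394 (3.23).  Inputs BY NAME: `B9Eq342CovariantResolventAdjointRowLetters.norm_apply_le_weighted_of_resolvent` (Kato, weighted),
`B9Eq342CovariantResolventAdjointRow.exists_adjRow_apriori`, `B9Eq340HolderRowOfGradientRow.norm_sub_le_of_step_bound` (path lemma), `B9Eq342CoshWeightBlockDistance.prod_cosh_torCast_eq`.
Nothing printed is a hypothesis; the `[cite: …]` tags are TEXT LOCATIONS.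

WHAT IS PROVED (sorry-free; proof lane — 0 `def`; the weight `Wt` and the operator `Tm` are letters pinned by equations as in the value-row file).
* §1 **`weight_le_exp_mul_of_tdist_le`** — `d(p, x) ≤ r` ⟹ `W_{x₀}(p) ≤ e^{a·d·r}·W_{x₀}(x)` (`a ≥ 0`; coordinatewise triangle inequality, `cosh(u + v) ≤ e^v cosh u`).
* §2 **`norm_sub_le_of_gradLetter`** — for `(Δ_{RS} + m)u = g` with `‖g(y)‖ ≤ G_s·W_{x₀}(y)` and a covariant-gradient letter `‖(D_Ru)(b)‖ ≤ Θ_∇·G_s·W_{x₀}(b₋)`: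
  `‖u(x′) − u(x)‖ ≤ d·d(x,x′)·(t⁻¹Θ_∇ + ελ⁻¹)·e^{a·d·(d(x,x′)+1)}·G_s·W_{x₀}(x)` (`λ = m − 2d·t²(cosh a − 1)`; `u(p + e_μ) − u(p) = t⁻¹(D_Ru)(p,μ) − (R − 1)u(p + e_μ)`).
* §3 `one_le_tdist_of_ne` (private), **`exists_holderAdjRow_apriori`** — SOME constant `Θ₀ ≥ 0` with
  `‖(G_mD*_Sf)(x′) − (G_mD*_Sf)(x)‖ ≤ Θ₀·F·(d(x,x′)∕ℓ)^β·W_{x₀}(x)` for `d(x,x′) ≤ ℓ` (finite dimension: the value a-priori bound at both points).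
HONEST SCOPE.  Letters only; the Hölder bootstrap, its tower instantiation and the `G′_k`-step are the next files; the FLAT two-point letter (Hölder row of `(L₀+m)⁻¹∂*`,
[B4] (1.9) at `A = 0` for the free massive resolvent) is NOT in the tree on the chain's carrier and will enter DISPLAYED.  NOT summit progress (cell pub-balaban: NE9 NOT
PRINTED ∕ NOT PROVED; «NE9 ⇐ the named binders»; row WALLED ON A MODEL (O-NE9-1; #5 UNRULED); spine PROVED 0∕9; rung (B)+1 finite T⁴ — NOT infinite volume, NOT mass gap,
NOT BetaPertH, NOT Clay).  HONEST DEPENDENCY (cell line): continuum YM on T⁴ ⇐ BetaPertH ∧ nine spine estimates (0/9 proved); BetaPertH ⇐ (D1) ∧ (D4) ∧ CAP+tail;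
G-an2-4 gates asym, D1 and NE2/3/4.  NEW file; nothing modified.  Net new unproved facts: 0.
-/

noncomputable section

open scoped InnerProductSpace ComplexConjugate BigOperators

namespace Literature.MathematicalPhysics.QuantumFieldTheory.Balaban1983to89.B9Eq343CovariantResolventHolderLetters

open B4Sect5Torus (TSite tdist tdist_nonneg tdist_triangle tdist_symm ccoord ccoord_triangle ccoord_cast ccoord_self circAbs_le_tdist)
open B4TorusKernel.MultiPeriod (circAbs circAbs_nonneg)
open B9SectCLatticeCarrier (Bond bpos btgt shift unshift)
open B9Eq311L2Pairing (WL2)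
open B9Eq33CovDerivVector (covDeriv covDeriv_apply_dir)
open B11Eq103H1Complex (SiteL2K BondL2K covDerivL2K covDivL2K covLaplaceSiteK greenK equiv_covDerivL2K)
open B9Eq342CoshWeightSite (weight_site_pos)
open B9Eq342CoshWeightBlockDistance (prod_cosh_torCast_eq)
open B9Eq340HolderRowOfGradientRow (norm_sub_le_of_step_bound)
open B9Eq342CovariantResolventAdjointRowLetters (norm_apply_le_weighted_of_resolvent)
open B9Eq342CovariantResolventAdjointRow (exists_adjRow_apriori wt_pos)

variable {d : ℕ} {P : Fin d → ℕ} [∀ i, NeZero (P i)] {W : Type*} [NormedAddCommGroup W] [InnerProductSpace ℂ W] [FiniteDimensional ℂ W]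
  {c₀ : ℝ} [Fact (0 < c₀)]

/-! ## §1 The weight over a sup-ball -/

/-- `cosh(u + v) ≤ e^v·cosh u` for `u, v ≥ 0`. [folklore] -/
private theorem cosh_add_le_exp_mul_cosh (u : ℝ) {v : ℝ} (hv : 0 ≤ v) : Real.cosh (u + v) ≤ Real.exp v * Real.cosh u := by
  rw [Real.cosh_add, ← Real.cosh_add_sinh v]
  have h1 : Real.sinh u ≤ Real.cosh u := (Real.sinh_lt_cosh u).le
  have h2 : 0 ≤ Real.sinh v := Real.sinh_nonneg_iff.mpr hv
  have h3 : 0 < Real.cosh u := Real.cosh_pos u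
  nlinarith [Real.cosh_pos v]

omit [∀ i, NeZero (P i)] in
/-- the coordinate distances are at most the sup-distance (real form). [folklore] -/
private theorem ccoord_le_tdist (hP : ∀ i, 1 ≤ P i) (x y : TSite d P) (i : Fin d) : (ccoord P x y i : ℝ) ≤ tdist P x y := by
  have h := circAbs_le_tdist hP x y i
  have h2 : ((ccoord P x y i : ℕ) : ℤ) = circAbs (P i) (((x i).val : ℤ) - ((y i).val : ℤ)) := ccoord_cast hP x y i
  have h3 : ((ccoord P x y i : ℕ) : ℝ) = (circAbs (P i) (((x i).val : ℤ) - ((y i).val : ℤ)) : ℝ) := by exact_mod_cast h2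
  rw [h3]; exact h

/-- **THE WEIGHT OVER A SUP-BALL**: for `a ≥ 0` and `d(p, x) ≤ r` (torus sup-distance), `W_{x₀}(p) ≤ e^{a·d·r}·W_{x₀}(x)` — per coordinate `c_i(x₀,p) ≤ c_i(x₀,x) + c_i(x,p)`,
`c_i(x,p) ≤ r`, `cosh` monotone, `cosh(u + v) ≤ e^v cosh u`. [folklore] [cite: Balaban1984PropagatorsI, p.36; Balaban1985BackgroundPropagators, (3.40) p.397] -/
theorem weight_le_exp_mul_of_tdist_le {a : ℝ} (ha : 0 ≤ a) (x₀ x p : TSite d P) {r : ℝ} (hr : tdist P p x ≤ r) :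
    ∏ μ, Real.cosh (a * (circAbs (P μ) ((((x₀ μ : ℕ) : ZMod (P μ)) - ((p μ : ℕ) : ZMod (P μ))).val) : ℝ)) ≤
      Real.exp (a * d * r) * ∏ μ, Real.cosh (a * (circAbs (P μ) ((((x₀ μ : ℕ) : ZMod (P μ)) - ((x μ : ℕ) : ZMod (P μ))).val) : ℝ)) := by
  have hP : ∀ i, 1 ≤ P i := fun i => Nat.one_le_iff_ne_zero.mpr (NeZero.ne (P i))
  rw [prod_cosh_torCast_eq a x₀ p, prod_cosh_torCast_eq a x₀ x]
  have hfac : ∀ μ : Fin d, Real.cosh (a * (ccoord P x₀ p μ : ℝ)) ≤ Real.exp (a * r) * Real.cosh (a * (ccoord P x₀ x μ : ℝ)) := by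
    intro μ
    have htri : (ccoord P x₀ p μ : ℝ) ≤ ccoord P x₀ x μ + ccoord P x p μ := by exact_mod_cast ccoord_triangle hP x₀ x p μ
    have hcp : (ccoord P x p μ : ℝ) ≤ r := by
      have := ccoord_le_tdist hP x p μ; rw [tdist_symm hP] at this; exact this.trans hr
    have h0 : (0 : ℝ) ≤ ccoord P x₀ p μ := Nat.cast_nonneg _
    have h1 : (0 : ℝ) ≤ ccoord P x₀ x μ := Nat.cast_nonneg _
    have h2 : (0 : ℝ) ≤ ccoord P x p μ := Nat.cast_nonneg _
    calc Real.cosh (a * (ccoord P x₀ p μ : ℝ)) ≤ Real.cosh (a * ccoord P x₀ x μ + a * ccoord P x p μ) := by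
          rw [Real.cosh_le_cosh, abs_of_nonneg (by positivity), abs_of_nonneg (by positivity), ← mul_add]
          exact mul_le_mul_of_nonneg_left htri ha
      _ ≤ Real.exp (a * ccoord P x p μ) * Real.cosh (a * ccoord P x₀ x μ) := cosh_add_le_exp_mul_cosh _ (by positivity)
      _ ≤ Real.exp (a * r) * Real.cosh (a * (ccoord P x₀ x μ : ℝ)) :=
          mul_le_mul_of_nonneg_right (Real.exp_le_exp.2 (mul_le_mul_of_nonneg_left hcp ha)) (Real.cosh_pos _).le
  calc ∏ μ, Real.cosh (a * (ccoord P x₀ p μ : ℝ)) ≤ ∏ μ, Real.exp (a * r) * Real.cosh (a * (ccoord P x₀ x μ : ℝ)) :=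
        Finset.prod_le_prod (fun μ _ => (Real.cosh_pos _).le) (fun μ _ => hfac μ)
    _ = Real.exp (a * d * r) * ∏ μ, Real.cosh (a * (ccoord P x₀ x μ : ℝ)) := by
        rw [Finset.prod_mul_distrib, Finset.prod_const, Finset.card_univ, Fintype.card_fin, ← Real.exp_nat_mul]; ring_nf

/-! ## §2 The two-point row of the covariant massive resolvent on weighted value data, from a gradient letter -/

omit [FiniteDimensional ℂ W] in
/-- **THE η-SCALE LIPSCHITZ ROW OF `(Δ_{RS} + m)⁻¹` ON WEIGHTED VALUE DATA**: `S(b)R(b) = 1`, contractions, `‖R(b)w − w‖ ≤ ε‖w‖`, the window `2d·t²(cosh a − 1) < m`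
(`a ≥ 0`, `t > 0`); if `Δ_{RS}u + m u = g` with `‖g(y)‖ ≤ G_s·W_{x₀}(y)` and the covariant gradient obeys `‖(D_Ru)(b)‖ ≤ Θ_∇·G_s·W_{x₀}(b₋)` (a DISPLAYED letter), then
for all sites `‖u(x′) − u(x)‖ ≤ d·d(x,x′)·(t⁻¹Θ_∇ + ελ⁻¹)·e^{a·d·(d(x,x′) + 1)}·G_s·W_{x₀}(x)` — each lattice step `u(p + e_μ) − u(p) = t⁻¹(D_Ru)(p,μ) − (R(p,μ) − 1)u(p + e_μ)`
is bounded by the letter and Kato's weighted value row inside the sup-ball, then the path lemma `norm_sub_le_of_step_bound`.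
[folklore] [cite: Balaban1985BackgroundPropagators, (3.40) p.397, (3.23) p.394, Thm 3.1 (3.42)–(3.43) pp.397–398] -/
theorem norm_sub_le_of_gradLetter (t : ℝ) (ht : 0 < t) (R S : Bond d P → W →ₗ[ℂ] W) (hSR : ∀ b w, S b (R b w) = w) (hRn : ∀ b w, ‖R b w‖ ≤ ‖w‖)
    (hSn : ∀ b w, ‖S b w‖ ≤ ‖w‖) {ε : ℝ} (hε : 0 ≤ ε) (hRε : ∀ b w, ‖R b w - w‖ ≤ ε * ‖w‖) {m a : ℝ} (hm : 0 < m) (ha : 0 ≤ a)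
    (hlam : 2 * (d : ℝ) * t ^ 2 * (Real.cosh a - 1) < m) {u g : SiteL2K ℂ d P c₀ W} (hug : covLaplaceSiteK (t : ℂ) R S u + (m : ℂ) • u = g) (x₀ : TSite d P)
    {Gs Θg : ℝ} (hGs : 0 ≤ Gs) (hΘg : 0 ≤ Θg)
    (hg : ∀ y, ‖WL2.equiv ℂ _ W g y‖ ≤ Gs * ∏ μ, Real.cosh (a * (circAbs (P μ) ((((x₀ μ : ℕ) : ZMod (P μ)) - ((y μ : ℕ) : ZMod (P μ))).val) : ℝ)))
    (hgrad : ∀ b : Bond d P, ‖WL2.equiv ℂ _ W (covDerivL2K ℂ c₀ (t : ℂ) R u) b‖ ≤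
      Θg * Gs * ∏ μ, Real.cosh (a * (circAbs (P μ) ((((x₀ μ : ℕ) : ZMod (P μ)) - ((bpos b μ : ℕ) : ZMod (P μ))).val) : ℝ)))
    (x x' : TSite d P) :
    ‖WL2.equiv ℂ _ W u x' - WL2.equiv ℂ _ W u x‖ ≤
      d * tdist P x x' * ((t⁻¹ * Θg + ε * (m - 2 * (d : ℝ) * t ^ 2 * (Real.cosh a - 1))⁻¹) * Real.exp (a * d * (tdist P x x' + 1)) * Gs) *
        ∏ μ, Real.cosh (a * (circAbs (P μ) ((((x₀ μ : ℕ) : ZMod (P μ)) - ((x μ : ℕ) : ZMod (P μ))).val) : ℝ)) := by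
  have hP : ∀ i, 1 ≤ P i := fun i => Nat.one_le_iff_ne_zero.mpr (NeZero.ne (P i))
  have hlam0 : 0 < m - 2 * (d : ℝ) * t ^ 2 * (Real.cosh a - 1) := by linarith
  set Wx : ℝ := ∏ μ, Real.cosh (a * (circAbs (P μ) ((((x₀ μ : ℕ) : ZMod (P μ)) - ((x μ : ℕ) : ZMod (P μ))).val) : ℝ)) with hWx
  set r : ℝ := tdist P x x' with hr
  have hr0 : 0 ≤ r := tdist_nonneg _ _ _
  set v := WL2.equiv ℂ _ W u with hv
  -- Kato's weighted value row for `u`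
  have hval : ∀ y, ‖v y‖ ≤ (m - 2 * (d : ℝ) * t ^ 2 * (Real.cosh a - 1))⁻¹ * Gs *
      ∏ μ, Real.cosh (a * (circAbs (P μ) ((((x₀ μ : ℕ) : ZMod (P μ)) - ((y μ : ℕ) : ZMod (P μ))).val) : ℝ)) := fun y =>
    norm_apply_le_weighted_of_resolvent (c₀ := c₀) t R S hSR hRn hSn hm hlam hug x₀ hGs hg y
  -- the step bound inside the ball
  refine (norm_sub_le_of_step_bound hP v x x' (B := (t⁻¹ * Θg + ε * (m - 2 * (d : ℝ) * t ^ 2 * (Real.cosh a - 1))⁻¹) *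
    Real.exp (a * d * (r + 1)) * Gs * Wx) (by positivity) fun p μ hp hp' => ?_).trans (le_of_eq (by rw [← hr]; ring))
  -- weights at `p` and `p + e_μ` against the weight at `x`
  have hWp : ∏ ν, Real.cosh (a * (circAbs (P ν) ((((x₀ ν : ℕ) : ZMod (P ν)) - ((p ν : ℕ) : ZMod (P ν))).val) : ℝ)) ≤ Real.exp (a * d * (r + 1)) * Wx :=
    (weight_le_exp_mul_of_tdist_le ha x₀ x p hp).trans
      (mul_le_mul_of_nonneg_right (Real.exp_le_exp.2 (by nlinarith [Nat.cast_nonneg (α := ℝ) d])) (weight_site_pos P a x₀ x).le)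
  have hWp' : ∏ ν, Real.cosh (a * (circAbs (P ν) ((((x₀ ν : ℕ) : ZMod (P ν)) - ((shift μ p ν : ℕ) : ZMod (P ν))).val) : ℝ)) ≤ Real.exp (a * d * (r + 1)) * Wx :=
    (weight_le_exp_mul_of_tdist_le ha x₀ x (shift μ p) hp').trans
      (mul_le_mul_of_nonneg_right (Real.exp_le_exp.2 (by nlinarith [Nat.cast_nonneg (α := ℝ) d])) (weight_site_pos P a x₀ x).le)
  -- the step identity `v(p + e_μ) − v(p) = t⁻¹(D_Rv)(p,μ) − (R − 1)v(p + e_μ)`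
  have hstep : v (shift μ p) - v p = (t : ℂ)⁻¹ • WL2.equiv ℂ _ W (covDerivL2K ℂ c₀ (t : ℂ) R u) (p, μ) - (R (p, μ) (v (shift μ p)) - v (shift μ p)) := by
    rw [equiv_covDerivL2K, covDeriv_apply_dir, ← hv, smul_smul, inv_mul_cancel₀ (by exact_mod_cast ht.ne'), one_smul]
    abel
  rw [hstep]
  have ht' : ‖(t : ℂ)⁻¹‖ = t⁻¹ := by rw [norm_inv, Complex.norm_real, Real.norm_eq_abs, abs_of_pos ht]
  calc ‖(t : ℂ)⁻¹ • WL2.equiv ℂ _ W (covDerivL2K ℂ c₀ (t : ℂ) R u) (p, μ) - (R (p, μ) (v (shift μ p)) - v (shift μ p))‖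
      ≤ ‖(t : ℂ)⁻¹ • WL2.equiv ℂ _ W (covDerivL2K ℂ c₀ (t : ℂ) R u) (p, μ)‖ + ‖R (p, μ) (v (shift μ p)) - v (shift μ p)‖ := norm_sub_le _ _
    _ ≤ t⁻¹ * (Θg * Gs * (Real.exp (a * d * (r + 1)) * Wx)) + ε * ((m - 2 * (d : ℝ) * t ^ 2 * (Real.cosh a - 1))⁻¹ * Gs * (Real.exp (a * d * (r + 1)) * Wx)) := by
        refine add_le_add ?_ ?_
        · rw [norm_smul, ht']
          exact mul_le_mul_of_nonneg_left ((hgrad (p, μ)).trans (mul_le_mul_of_nonneg_left hWp (by positivity))) (inv_pos.2 ht).le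
        · exact (hRε _ _).trans (mul_le_mul_of_nonneg_left ((hval _).trans (mul_le_mul_of_nonneg_left hWp' (by positivity))) hε)
    _ = (t⁻¹ * Θg + ε * (m - 2 * (d : ℝ) * t ^ 2 * (Real.cosh a - 1))⁻¹) * Real.exp (a * d * (r + 1)) * Gs * Wx := by ring

/-! ## §3 The two-point a-priori bound of `(Δ_{RS} + m)⁻¹D*_S` in the Hölder currency -/

omit [∀ i, NeZero (P i)] in
/-- distinct sites are at sup-distance `≥ 1`. [folklore] -/
private theorem one_le_tdist_of_ne (hP : ∀ i, 1 ≤ P i) {x y : TSite d P} (hxy : x ≠ y) : 1 ≤ tdist P x y := by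
  obtain ⟨i, hi⟩ : ∃ i, x i ≠ y i := Function.ne_iff.mp hxy
  have hc : 1 ≤ ccoord P x y i := by
    rcases Nat.eq_zero_or_pos (ccoord P x y i) with h00 | hpos'
    swap
    · exact hpos'
    exfalso
    have hz : circAbs (P i) (((x i).val : ℤ) - ((y i).val : ℤ)) = 0 := by rw [← ccoord_cast hP, h00]; rfl
    -- `circAbs = 0` forces the coordinates to agree (both are `< P i`)
    have hmod : (((x i).val : ℤ) - ((y i).val : ℤ)) % (P i : ℤ) = 0 := by
      unfold B4TorusKernel.MultiPeriod.circAbs at hz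
      have hPi : (0 : ℤ) < P i := by exact_mod_cast hP i
      have hlt := Int.emod_lt_of_pos (((x i).val : ℤ) - ((y i).val : ℤ)) hPi
      have hnn := Int.emod_nonneg (((x i).val : ℤ) - ((y i).val : ℤ)) hPi.ne'
      rcases min_eq_iff.mp hz with ⟨h, -⟩ | ⟨h, -⟩
      · exact h
      · omega
    have hdvd : (P i : ℤ) ∣ ((x i).val : ℤ) - ((y i).val : ℤ) := Int.dvd_of_emod_eq_zero hmod
    have hxlt : ((x i).val : ℤ) < P i := by exact_mod_cast (x i).isLt
    have hylt : ((y i).val : ℤ) < P i := by exact_mod_cast (y i).isLt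
    have habs : |((x i).val : ℤ) - ((y i).val : ℤ)| < P i := by rw [abs_lt]; constructor <;> linarith
    have h0 := Int.eq_zero_of_abs_lt_dvd hdvd habs
    exact hi (Fin.ext (by exact_mod_cast (sub_eq_zero.mp h0)))
  have h1 : ((ccoord P x y i : ℕ) : ℝ) ≤ tdist P x y := by
    unfold tdist; exact_mod_cast Finset.le_sup (f := ccoord P x y) (Finset.mem_univ i)
  exact le_trans (by exact_mod_cast hc) h1

/-- **THE TWO-POINT A-PRIORI BOUND (finite dimension)**: for `0 < β`, `0 < ℓ`, `a ≥ 0`, there is `Θ₀ ≥ 0` with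
`‖(G_mD*_Sf)(x′) − (G_mD*_Sf)(x)‖ ≤ Θ₀·F·(d(x,x′)∕ℓ)^β·W_{x₀}(x)` whenever `d(x,x′) ≤ ℓ`, `F ≥ 0`, `‖f(b)‖ ≤ F·W_{x₀}(b₋)` — the value a-priori bound
(`B9Eq342CovariantResolventAdjointRow.exists_adjRow_apriori`) at both points, the weight over the ball, and `d(x,x′) ≥ 1` for `x ≠ x′`. [folklore]
[cite: Balaban1985BackgroundPropagators, (3.40) p.397, (3.11) p.392] -/
theorem exists_holderAdjRow_apriori (t : ℝ) {a ℓ β : ℝ} (ha : 0 ≤ a) (hl : 0 < ℓ) (hβ0 : 0 < β) (S : Bond d P → W →ₗ[ℂ] W)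
    (Wt : TSite d P → TSite d P → ℝ) (hWt : ∀ x₀ y, Wt x₀ y = ∏ μ, Real.cosh (a * (circAbs (P μ) ((((x₀ μ : ℕ) : ZMod (P μ)) - ((y μ : ℕ) : ZMod (P μ))).val) : ℝ)))
    (Tm : SiteL2K ℂ d P c₀ W →ₗ[ℂ] SiteL2K ℂ d P c₀ W) (hpos : ∀ x : SiteL2K ℂ d P c₀ W, x ≠ 0 → 0 < RCLike.re ⟪x, Tm x⟫_ℂ) :
    ∃ Θ₀ : ℝ, 0 ≤ Θ₀ ∧ ∀ (x₀ : TSite d P) (f : BondL2K ℂ d P c₀ W) (F : ℝ), 0 ≤ F → (∀ b, ‖WL2.equiv ℂ _ W f b‖ ≤ F * Wt x₀ (bpos b)) →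
      ∀ x x', tdist P x x' ≤ ℓ →
        ‖WL2.equiv ℂ _ W (greenK Tm hpos (covDivL2K ℂ c₀ (t : ℂ) S f)) x' - WL2.equiv ℂ _ W (greenK Tm hpos (covDivL2K ℂ c₀ (t : ℂ) S f)) x‖ ≤
          Θ₀ * F * (tdist P x x' / ℓ) ^ β * Wt x₀ x := by
  have hP : ∀ i, 1 ≤ P i := fun i => Nat.one_le_iff_ne_zero.mpr (NeZero.ne (P i))
  obtain ⟨Θv, hΘv, hv⟩ := exists_adjRow_apriori (P := P) (c₀ := c₀) (W := W) t (a := a) S Wt hWt Tm hpos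
  have hρmin : 0 < (1 / ℓ) ^ β := Real.rpow_pos_of_pos (by positivity) β
  refine ⟨Θv * (Real.exp (a * d * ℓ) + 1) / (1 / ℓ) ^ β, by positivity, ?_⟩
  intro x₀ f F hF hf x x' hxx
  by_cases hxe : x = x'
  · subst hxe; rw [sub_self, norm_zero]
    exact mul_nonneg (mul_nonneg (mul_nonneg (by positivity) hF) (Real.rpow_nonneg (div_nonneg (tdist_nonneg _ _ _) hl.le) β)) (wt_pos (a := a) Wt hWt x₀ x).le
  · have h1 := hv x₀ f F hF hf x
    have h2 := hv x₀ f F hF hf x'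
    have hW' : Wt x₀ x' ≤ Real.exp (a * d * ℓ) * Wt x₀ x := by
      rw [hWt, hWt]; exact weight_le_exp_mul_of_tdist_le ha x₀ x x' (by rw [tdist_symm hP]; exact hxx)
    have hρ : (1 / ℓ) ^ β ≤ (tdist P x x' / ℓ) ^ β :=
      Real.rpow_le_rpow (by positivity) (div_le_div_of_nonneg_right (one_le_tdist_of_ne hP hxe) hl.le) hβ0.le
    have hW0 := (wt_pos (a := a) Wt hWt x₀ x).le
    calc ‖WL2.equiv ℂ _ W (greenK Tm hpos (covDivL2K ℂ c₀ (t : ℂ) S f)) x' - WL2.equiv ℂ _ W (greenK Tm hpos (covDivL2K ℂ c₀ (t : ℂ) S f)) x‖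
        ≤ Θv * F * Wt x₀ x' + Θv * F * Wt x₀ x := (norm_sub_le _ _).trans (add_le_add h2 h1)
      _ ≤ Θv * F * (Real.exp (a * d * ℓ) * Wt x₀ x) + Θv * F * Wt x₀ x := by gcongr
      _ = Θv * (Real.exp (a * d * ℓ) + 1) / (1 / ℓ) ^ β * F * (1 / ℓ) ^ β * Wt x₀ x := by field_simp
      _ ≤ Θv * (Real.exp (a * d * ℓ) + 1) / (1 / ℓ) ^ β * F * (tdist P x x' / ℓ) ^ β * Wt x₀ x := by gcongr

end Literature.MathematicalPhysics.QuantumFieldTheory.Balaban1983to89.B9Eq343CovariantResolventHolderLetters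

end
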